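import Literature.NumberTheory.EllipticCurves.FormalGroupNilIdealPointsTranslate
import HarnessLib

/-!
# The CM transformation identity at points of the formal group: `x(P₁^α ⊕ P([α] t)) = R(x(P₁ ⊕ P(t)))` in `K`
# (de Shalit II.1.10 / II.4.9 (ii), the `𝔓`-adic evaluation step — proofs only)

Topic `NumberTheory/EllipticCurves` (theorems only; no definition, no named fact, no instance).  Setting of
`FormalGroupNilIdealPoints(Translate)`: `K` a complete ultrametric field, `A` a discrete coefficient ring acting on `𝒪_K`, `W/A`,
`P(t) = ptOfZ K W t ∈ E₁(K)`, and the `t`-expansions `translateX x₀ y₀`, `translateY x₀ y₀` of the coordinates of `P₀ ⊕ P(t)`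
(`some_add_ptOfZ`).  INPUT (a hypothesis, produced over `ℂ` by `CMFormalActionTaylorProofs.translateX_subst_formalMulBy_add_C_mul_aeval_eq`
and descended to `A`): a series `T ∈ A⟦X⟧` without constant term (the formal multiplication `[α]_Ê`), polynomials `P, Q ∈ A[X]`
(the transformation polynomials of `℘(αz) = P(℘)/Q(℘)`), a shift `b` (`= b₂/12`) and two integral points `(x₀, y₀)`, `(x₁, y₁)` (`ξ(Ω)`,
`ξ(αΩ)`) with **`(translateX(x₁, y₁) ∘ T + C b) · Q(translateX(x₀, y₀) + C b) = P(translateX(x₀, y₀) + C b)`** in `A⟦X⟧`.  OUTPUT: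

* §0 DESCENT: `subst_add_C_mul_aeval_eq_of_map_eq`, `translateX_subst_add_C_mul_aeval_eq_of_map` — the series identity holds over
  a ring `R` as soon as its image under an INJECTIVE `φ : R →+* S` holds over `S` (`PowerSeries.map_injective`, `map_translateX`,
  `map_subst`); so the `ℂ`-identity of `CMFormalActionTaylorProofs` descends to any subring of `ℂ` containing the data, with `T` any lift
  of `[α]_Ê` (`T.map φ = exp_W.subst (C α * log_W)`, cf. `FormalGroupPadicIntEndomorphisms.exists_map_eq_formalExp_subst_C_mul_formalLog`);
* `evalAt_aeval` — evaluation at a point commutes with polynomial expressions (`A`-algebra maps);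
* ★★ `coe_evalAt_translateX_subst_add_mul_eval_eq` — **at every `t ∈ 𝔪_K`:
  `(x(P₁^α ⊕ P(T(t))) + b) · Q(x(P₁ ⊕ P(t)) + b) = P(x(P₁ ⊕ P(t)) + b)` in `K`**, where `x(P ⊕ P(s))` is the value of
  `translateX` at `s` (`= ` the `x`-coordinate of `P ⊕ P(s)` by `some_add_ptOfZ`) — the identity «`x([α]U) = R(x(U))`» on the translate
  `P₁ ⊕ E₁(K)` with `[α]` read as `P(s) ↦ P(T(s))` on the formal group: ingredient (CM-POINTS)(ii) of the cell's CM bridge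
  (memo `Cruxes/TwoVariableMainConjAtSplitTwoQuad/PRINT-DRAFT-II15-w4g14.md` §3), `x`-coordinate.
* `coe_evalAt_translateX_subst_eq_div` — the solved form `x(P₁^α ⊕ P(T t)) = P(·)/Q(·) − b` when `Q(x(P₁ ⊕ P(t)) + b) ≠ 0`.

Cell `bsd-print-cf2`, width seat `bsd-line-cf2c-w4` g14; no summit statement is proved; BSD is not proved by any of this.

## References
* [deShalit1987] E. de Shalit, *Iwasawa theory of elliptic curves with complex multiplication* (1987), II §1.10, §4.9 (ii).
* [SilvermanATAEC1994] J. H. Silverman, *Advanced Topics in the Arithmetic of Elliptic Curves* (1994), II Prop. 1.1, §II.2.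
* [SilvermanAEC2009] J. H. Silverman, *The Arithmetic of Elliptic Curves*, 2nd ed. (2009), VII.2.2.
-/

noncomputable section

open scoped Classical
open PowerSeries

namespace Literature.NumberTheory.EllipticCurves

open Literature.NumberTheory.GaloisRepresentations.LubinTate
open Literature.NumberTheory.EllipticCurves.FormalGroupChart _root_.WeierstrassCurve

/-! ## §0 Descent of the series identity along an injective coefficient map -/

section Descent

variable {R S : Type*} [CommRing R] [CommRing S] (φ : R →+* S)

/-- `map φ` intertwines the constants: `(algebraMap S S⟦X⟧) ∘ φ = map φ ∘ (algebraMap R R⟦X⟧)`. [cite: SilvermanAEC2009, IV.1] -/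
theorem algebraMap_comp_eq_map_comp_algebraMap :
    (algebraMap S (PowerSeries S)).comp φ = (PowerSeries.map φ).comp (algebraMap R (PowerSeries R)) := by
  refine RingHom.ext fun r => ?_
  rw [RingHom.comp_apply, RingHom.comp_apply]
  change C (φ r) = PowerSeries.map φ (C r)
  rw [PowerSeries.map_C]

/-- **Descent of the identity `(F₁ ∘ T + b)·Q(F₀ + b) = P(F₀ + b)` along an injective `φ : R →+* S`**: it holds over `R` as soon as its
coefficientwise image holds over `S`. [cite: SilvermanATAEC1994, II §2] [cite: SilvermanAEC2009, IV.1] -/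
theorem subst_add_C_mul_aeval_eq_of_map_eq (hφ : Function.Injective φ) {F₀ F₁ T : PowerSeries R}
    (hT : constantCoeff T = 0) {b : R} {P Q : Polynomial R}
    (h : (PowerSeries.subst (T.map φ) (F₁.map φ) + C (φ b)) * Polynomial.aeval (F₀.map φ + C (φ b)) (Q.map φ) =
      Polynomial.aeval (F₀.map φ + C (φ b)) (P.map φ)) :
    (PowerSeries.subst T F₁ + C b) * Polynomial.aeval (F₀ + C b) Q = Polynomial.aeval (F₀ + C b) P := by
  apply PowerSeries.map_injective φ hφ
  have hcomm := algebraMap_comp_eq_map_comp_algebraMap φ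
  have hs : PowerSeries.map φ (PowerSeries.subst T F₁) = PowerSeries.subst (T.map φ) (F₁.map φ) :=
    PowerSeries.map_subst (PowerSeries.HasSubst.of_constantCoeff_zero' hT) (h := φ) F₁
  rw [map_mul, map_add, hs, PowerSeries.map_C, Polynomial.map_aeval_eq_aeval_map hcomm, Polynomial.map_aeval_eq_aeval_map hcomm,
    map_add, PowerSeries.map_C]
  exact h

/-- **The translate form of the descent**: for `W/R`, points `(x₀,y₀), (x₁,y₁)`, a series `T` and polynomials over `R`, the identity
`(translateX(x₁,y₁) ∘ T + C b)·Q(translateX(x₀,y₀) + C b) = P(translateX(x₀,y₀) + C b)` over `R` follows from the same identity over `S`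
for `W.map φ`, `φ xᵢ`, `φ yᵢ`, `T.map φ`, `P.map φ`, `Q.map φ` (`map_translateX`). [cite: SilvermanATAEC1994, II §2] [cite: deShalit1987, II §4.9 (i)] -/
theorem translateX_subst_add_C_mul_aeval_eq_of_map (hφ : Function.Injective φ) (W : WeierstrassCurve R) {x₀ y₀ x₁ y₁ b : R}
    {T : PowerSeries R} (hT : constantCoeff T = 0) {P Q : Polynomial R}
    (h : (PowerSeries.subst (T.map φ) ((W.map φ).translateX (φ x₁) (φ y₁)) + C (φ b)) *
        Polynomial.aeval ((W.map φ).translateX (φ x₀) (φ y₀) + C (φ b)) (Q.map φ) =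
      Polynomial.aeval ((W.map φ).translateX (φ x₀) (φ y₀) + C (φ b)) (P.map φ)) :
    (PowerSeries.subst T (W.translateX x₁ y₁) + C b) * Polynomial.aeval (W.translateX x₀ y₀ + C b) Q =
      Polynomial.aeval (W.translateX x₀ y₀ + C b) P := by
  refine subst_add_C_mul_aeval_eq_of_map_eq φ hφ hT ?_
  rw [map_translateX, map_translateX]
  exact h

end Descent

variable {A : Type*} [CommRing A] [UniformSpace A] [DiscreteUniformity A]
  {K : Type*} [NontriviallyNormedField K] [IsUltrametricDist K] [CompleteSpace K]
  [Algebra A (unitBall K)] [ContinuousSMul A (unitBall K)] {W : WeierstrassCurve A}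

/-- **Evaluation at a point commutes with polynomial expressions**: `evalAt t (p(F)) = p(evalAt t F)` for `p ∈ A[X]`, `F ∈ A⟦X⟧`
(`evalAt t` is an `A`-algebra map). [cite: SilvermanAEC2009, VII.2.2] -/
theorem evalAt_aeval (t : (ballNilIdeal K).toIdeal) (p : Polynomial A) (F : PowerSeries A) :
    evalAt (ballNilIdeal K) t (Polynomial.aeval F p) = Polynomial.aeval (evalAt (ballNilIdeal K) t F) p :=
  (Polynomial.aeval_algHom_apply (evalAt (ballNilIdeal K) t) F p).symm

omit [UniformSpace A] [DiscreteUniformity A] [CompleteSpace K] [ContinuousSMul A (unitBall K)] in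
/-- A polynomial expression read in `K`: `↑(p(u)) = (p.map (A → K))(↑u)` for `u ∈ 𝒪_K`. [cite: SilvermanAEC2009, VII.2.2] -/
theorem coe_aeval_unitBall (p : Polynomial A) (u : unitBall K) :
    ((Polynomial.aeval u p : unitBall K) : K) = (p.map (algebraMap A (unitBall K))).eval₂ (unitBall K).subtype u := by
  rw [Polynomial.aeval_def, Polynomial.eval₂_map]
  exact Polynomial.hom_eval₂ p (algebraMap A (unitBall K)) (unitBall K).subtype u

/-- ★★ **The CM transformation identity at points of the formal group** (`x`-coordinate): from the series identity
`(translateX(x₁,y₁) ∘ T + C b) · Q(translateX(x₀,y₀) + C b) = P(translateX(x₀,y₀) + C b)` in `A⟦X⟧` (`T(0) = 0`), at every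
`t ∈ 𝔪_K`: **`(X₁(T(t)) + b) · Q(X₀(t) + b) = P(X₀(t) + b)`** in `𝒪_K`, where `X₀(t) = translateX(x₀,y₀)(t) = x(P₁ ⊕ P(t))` and
`X₁(T(t)) = x(P₁^α ⊕ P(T(t)))` (`some_add_ptOfZ`) — «`x([α] U) = R(x U)`» for `U = P₁ ⊕ P(t)`, with `[α]` acting on the formal
group by the series `T`. [cite: deShalit1987, II §1.10, §4.9 (ii)] [cite: SilvermanATAEC1994, II Prop. 1.1] -/
theorem evalAt_translateX_subst_add_mul_aeval_eq {x₀ y₀ x₁ y₁ b : A} {T : PowerSeries A} (hT : constantCoeff T = 0)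
    {P Q : Polynomial A}
    (hid : ((W.translateX x₁ y₁).subst T + C b) * Polynomial.aeval (W.translateX x₀ y₀ + C b) Q =
      Polynomial.aeval (W.translateX x₀ y₀ + C b) P)
    (t : (ballNilIdeal K).toIdeal) :
    (evalAt (ballNilIdeal K) (evalPt₁ (ballNilIdeal K) T hT t) (W.translateX x₁ y₁) + algebraMap A (unitBall K) b) *
        Polynomial.aeval (evalAt (ballNilIdeal K) t (W.translateX x₀ y₀) + algebraMap A (unitBall K) b) Q =
      Polynomial.aeval (evalAt (ballNilIdeal K) t (W.translateX x₀ y₀) + algebraMap A (unitBall K) b) P := by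
  have h := congrArg (evalAt (ballNilIdeal K) t) hid
  rw [map_mul, map_add, evalAt_subst₁ t T hT, evalAt_C', evalAt_aeval, evalAt_aeval, map_add, evalAt_C'] at h
  exact h

/-- The same identity read in `K`. [cite: deShalit1987, II §1.10, §4.9 (ii)] -/
theorem coe_evalAt_translateX_subst_add_mul_eval_eq {x₀ y₀ x₁ y₁ b : A} {T : PowerSeries A} (hT : constantCoeff T = 0)
    {P Q : Polynomial A}
    (hid : ((W.translateX x₁ y₁).subst T + C b) * Polynomial.aeval (W.translateX x₀ y₀ + C b) Q =
      Polynomial.aeval (W.translateX x₀ y₀ + C b) P)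
    (t : (ballNilIdeal K).toIdeal) :
    (((evalAt (ballNilIdeal K) (evalPt₁ (ballNilIdeal K) T hT t) (W.translateX x₁ y₁) : unitBall K) : K) + cK K b) *
        (Q.map (algebraMap A (unitBall K))).eval₂ (unitBall K).subtype
          (evalAt (ballNilIdeal K) t (W.translateX x₀ y₀) + algebraMap A (unitBall K) b) =
      (P.map (algebraMap A (unitBall K))).eval₂ (unitBall K).subtype
          (evalAt (ballNilIdeal K) t (W.translateX x₀ y₀) + algebraMap A (unitBall K) b) := by
  have h := congrArg (fun u : unitBall K => (u : K)) (evalAt_translateX_subst_add_mul_aeval_eq (K := K) (W := W) hT hid t)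
  simp only [Subring.coe_mul, Subring.coe_add, coe_aeval_unitBall] at h
  exact h

/-- ★ **Solved form**: where `Q(x(P₁ ⊕ P(t)) + b) ≠ 0`, **`x(P₁^α ⊕ P(T t)) = P(x(P₁ ⊕ P(t)) + b)/Q(x(P₁ ⊕ P(t)) + b) − b`** in `K`.
[cite: deShalit1987, II §4.9 (ii)] [cite: SilvermanATAEC1994, II Prop. 1.1] -/
theorem coe_evalAt_translateX_subst_eq_div {x₀ y₀ x₁ y₁ b : A} {T : PowerSeries A} (hT : constantCoeff T = 0)
    {P Q : Polynomial A}
    (hid : ((W.translateX x₁ y₁).subst T + C b) * Polynomial.aeval (W.translateX x₀ y₀ + C b) Q =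
      Polynomial.aeval (W.translateX x₀ y₀ + C b) P)
    (t : (ballNilIdeal K).toIdeal)
    (hQ : (Q.map (algebraMap A (unitBall K))).eval₂ (unitBall K).subtype
      (evalAt (ballNilIdeal K) t (W.translateX x₀ y₀) + algebraMap A (unitBall K) b) ≠ 0) :
    (((evalAt (ballNilIdeal K) (evalPt₁ (ballNilIdeal K) T hT t) (W.translateX x₁ y₁) : unitBall K) : K)) =
      (P.map (algebraMap A (unitBall K))).eval₂ (unitBall K).subtype
          (evalAt (ballNilIdeal K) t (W.translateX x₀ y₀) + algebraMap A (unitBall K) b) /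
        (Q.map (algebraMap A (unitBall K))).eval₂ (unitBall K).subtype
          (evalAt (ballNilIdeal K) t (W.translateX x₀ y₀) + algebraMap A (unitBall K) b) - cK K b := by
  have h := coe_evalAt_translateX_subst_add_mul_eval_eq (K := K) (W := W) hT hid t
  rw [eq_sub_iff_add_eq, eq_div_iff hQ]
  exact h

end Literature.NumberTheory.EllipticCurves

end
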